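import Summits.AtomisticToContinuum.Crystallization.Theorems.FrustratedLawDichotomyAperiodicGapRecordJunctionHomFloorF6pT26

/-!
# Strained patch — «SoftSplit»: the pair bridge (D_GB⋆) and the cover (K⋆) cut along the STIFF ⊕ SOFT splitting of the chart residual

decomp-a2c lens-5 g85 NODE (crux `AperiodicFrustratedLawGap`, stmt-AtomisticToContinuum-27623, T-side [CORE-FAR] of record
`CoreOffTubeFloor (63/10) (63/10) (24/5) (1/100) 0` and route (F) `ρ = 26/5`).  Imports the landed junction of record `…AperiodicGapRecordJunctionHomFloorGraded` (p854038; it imports the graded record `…PairTubeRecordGraded`, p854011).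

§4 serves the ROUTE OF RECORD (F₆′) (p854038): RIM + [CORE-FAR] at `26/5` and the crux BY NAME with BOTH far T-leaves split, in literal-generic form
(any `μT, A, m, μ`) and at the T22/μ₇₈ and (α)-switch T26/μ₇₄ literals.

THE CUT.  The two UNDECIDED analytic T-leaves of record — the pair refinement (D_GB⋆) `RefineGBRecBy FamP 𝓘 βf sf` and the coarse cover (K⋆)
`FamilyCoverGRec FamP` — both assert that an admissible (force-capped, window-honest) clean mono-phase far-class cluster deviates LITTLE from a bent
host: (K⋆) in site currency at `1/25`, (D_GB⋆) in pair currency on the score-relevant pairs.  The mechanism everybody names for them is interior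
regularity of the equilibrium residual — which is a COERCIVITY argument, and coercivity is exactly what strained LJ hosts in the window `[1/20, 1/8)` do
NOT uniformly have (lens-4 I-B9-lite: homogeneous LJ-fcc is phonon/Born-unstable from Bain strain 0.036, {111}⟨11-2⟩ shear 0.044; lens-5 g50 SLACK50: the
record host FZ12's interior Hessian is INDEFINITE).  This file separates the two regimes INSIDE each leaf, by splitting the residual `D` of a chart into a
SOFT component `v ∈ 𝓥(z₀)` (a host-indexed family of admissible correction fields — intended instance: the span of the near-kernel / negative
eigenvectors of the host's block Hessian `hessBlk0` (…QuantSlaving) on the charted ball, at the admissible amplitudes) and the STIFF remainder `D − v∘e`: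

  (D_GB⋆)(β, s; 1/25)  ⟸  (T) `RefineGBS FamP 𝓘 𝓥 … τ₁ (constTol τ₁) (relConeBy 2 β₁ s₁ τ₁)`   [ANALYTIC · the STIFF leaf: after subtracting an admissible soft
                              field the residual is pair-cone small — coercive interior regularity (toy rung `…SoftSplitToy.stiff_component_le`:
                              `λ‖w‖ ≤ ‖H u‖` on the stiff subspace); WEAKER than (D_GB⋆) whenever `0 ∈ 𝓥` (`refineGBS_of_refineGB`); UNDECIDED]
                        ∧  (S) `SoftEnvelope 𝓥 τ₂ (constTol τ₂) (relConeBy 2 β₂ s₂ τ₂)`          [KINEMATIC × ANHARMONIC · the SOFT leaf: the admissible soft content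
                              has site amplitude `≤ τ₂` and relevant-pair oscillation `≤ β₂ + s₂ℓ` — per unit amplitude a FINITE computation on the modes,
                              the amplitude bound is the anharmonic force balance; UNDECIDED · INSTRUMENTABLE «SOFT-85»]
                        ∧  the bridge `τ₁ + τ₂ ≤ 1/25`, `β₁ + β₂ ≤ β`, `s₁ + s₂ ≤ s` (host by host)                         [arithmetic, here]
  and identically (K⋆)(1/25) ⟸ (K_S) `FamilyCoverGS FamP 𝓥 … τ₁ (constTol τ₁)` ∧ (S) ∧ `τ₁ + τ₂ ≤ 1/25` (§4).

RECOVERY: at `𝓥 = zeroModes` the stiff leaves ARE the record leaves (`refineGBS_zeroModes_iff`, `familyCoverGS_zeroModes_iff`) and (S) is free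
(`softEnvelope_zeroModes`) — the record is the degenerate instance; the trade is monotone (`RefineGBS.mono_modes` / `SoftEnvelope.anti_modes`): enlarging
`𝓥` weakens (T) and strengthens (S).  [CORE-FAR] of record, route (F) and the crux BY NAME follow through the landed graded junction (§3).

No new analysis is claimed: every theorem here is bookkeeping (triangle inequalities, case splits); the content is the PLACEMENT of the two regimes
(stiff: coercive, known-type; soft: finite-dimensional, anharmonic, instrumentable) as separately typed leaves with an exact seam.  0 sorry.
-/

noncomputable section

open scoped BigOperators Classical
open Literature.Analysis.ValidatedNumerics.Numerics (SC)
open Summit.AtomisticToContinuum.Crystallization.Theorems.FrustratedLawDichotomyAperiodicGapRecordJunctionHomFloorF6pT26 (level_ok_fallback_A35000_T26)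
open Summit.AtomisticToContinuum.Crystallization.Theorems.ChargedEnergyGapNegative (eStar E3)
open Summit.AtomisticToContinuum.Crystallization.Theorems.FrustratedLawDichotomyRangeCut
open Summit.AtomisticToContinuum.Crystallization.Theorems.FrustratedLawDichotomySchurCut
open Summit.AtomisticToContinuum.Crystallization.Theorems.FrustratedLawDichotomyMotifLemmas (GoodAtScale)
open Summit.AtomisticToContinuum.Crystallization.Theorems.FrustratedLawDichotomyAveragingCut (ballAvg)
open Summit.AtomisticToContinuum.Crystallization.Theorems.FrustratedLawDichotomyExemptLocOpt (LocOptFails)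
open Summit.AtomisticToContinuum.Crystallization.Theorems.FrustratedLawDichotomyExemptSplit (SchurElasticPricingX)
open Summit.AtomisticToContinuum.Crystallization.Theorems.FrustratedLawDichotomyExemptAbsorptionRecord
open Summit.AtomisticToContinuum.Crystallization.Theorems.FrustratedLawDichotomyCollarCensus
open Summit.AtomisticToContinuum.Crystallization.Theorems.FrustratedLawDichotomyCollarCensusKappa
open Summit.AtomisticToContinuum.Crystallization.Theorems.FrustratedLawDichotomyStrainedPatchHomSplit
open Summit.AtomisticToContinuum.Crystallization.Theorems.FrustratedLawDichotomyStrainedPatchCleanCollar (CleanBall TailPenalty AnnularDefectFloor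
  DefectiveCollarFloor tailOut)
open Summit.AtomisticToContinuum.Crystallization.Theorems.FrustratedLawDichotomyStrainedPatchPhaseCut (MonoPhaseBall AnnularPhaseFloor PolyTextureFloor
  monoPhaseBall_comp_iff FccGoodAtScale)
open Summit.AtomisticToContinuum.Crystallization.Theorems.FrustratedLawDichotomyStrainedPatchCoreTube (NearHomIsoAt CoreOffTubeFloor RimOffTubeFloor nearHomIsoAt_comp_iff)
open Summit.AtomisticToContinuum.Crystallization.Theorems.FrustratedLawDichotomyStrainedPatchCoreTubeRecord (CoreCoreRelief)
open Summit.AtomisticToContinuum.Crystallization.Theorems.FrustratedLawDichotomyStrainedPatchStrainBands (EdgeFarFloor coreOff_iff_edge_and_soft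
  softFarFloor_eighth)
open Summit.AtomisticToContinuum.Crystallization.Theorems.FrustratedLawDichotomyStrainedPatchHomIsometry (admissible_comp_iff goodAtScale_comp_iff
  dist_comp injective_comp_iff)
open Summit.AtomisticToContinuum.Crystallization.Theorems.FrustratedLawDichotomyStrainedPatchHomTubeIso (cleanBall_comp_iff ballAvg_xRec_comp)
open Summit.AtomisticToContinuum.Crystallization.Theorems.FrustratedLawDichotomyStrainedPatchChartFamilies (ChartBy FamilyLE familyLE_refl
  ChartBy.mono_t ChartBy.mono_family)
open Summit.AtomisticToContinuum.Crystallization.Theorems.FrustratedLawDichotomyStrainedPatchHostCells (TubeFloor FamilyCover FamP)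
open Summit.AtomisticToContinuum.Crystallization.Theorems.FrustratedLawDichotomyStrainedPatchQuantSlaving (ChartFam SlackTab)
open Summit.AtomisticToContinuum.Crystallization.Theorems.FrustratedLawDichotomyStrainedPatchGradedTube
open Summit.AtomisticToContinuum.Crystallization.Theorems.FrustratedLawDichotomyStrainedPatchCoverBridge
open Summit.AtomisticToContinuum.Crystallization.Theorems.FrustratedLawDichotomyStrainedPatchPairTube
open Summit.AtomisticToContinuum.Crystallization.Theorems.FrustratedLawDichotomyStrainedPatchHomCertTree (CertTree treeOK)
open Summit.AtomisticToContinuum.Crystallization.Theorems.FrustratedLawDichotomyStrainedPatchHomEntryGram (rootC rootW)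
open Summit.AtomisticToContinuum.Crystallization.Theorems.FrustratedLawDichotomyStrainedPatchHomEntryGramHcp (rootCH rootWH)
open Summit.AtomisticToContinuum.Crystallization.Theorems.FrustratedLawDichotomyStrainedPatchHomEntryLeafHT (entryLeafOK6RBKP4 semOKH)
open Summit.AtomisticToContinuum.Crystallization.Theorems.FrustratedLawDichotomyAperiodicGapRecordJunctionHomFloorF6p
open Summit.AtomisticToContinuum.Crystallization.Theorems.FrustratedLawDichotomyAperiodicGapRecordJunctionHomFloorGraded

namespace Summit.AtomisticToContinuum.Crystallization.Theorems.FrustratedLawDichotomyStrainedPatchSoftSplit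

/-! ## §0. Host-indexed families of admissible SOFT correction fields -/

/-- The type of MODE FAMILIES: host `(M₀, z₀, c₀)` ↦ the set of admissible soft correction fields `v : Fin M₀ → E3` on the host's sites. -/
abbrev ModeFam : Type := (M₀ : ℕ) → (Fin M₀ → E3) → Fin M₀ → (Fin M₀ → E3) → Prop

/-- (piece) [route statement · this cell; NOT a literature fact] The degenerate family: only the zero field (the record is this instance). -/
def zeroModes : ModeFam := fun _ _ _ v => v = 0

/-- (piece) [route statement · this cell; NOT a literature fact] `ZeroMem 𝓥` — the zero field is admissible at every host. -/
def ZeroMem (𝓥 : ModeFam) : Prop := ∀ (M₀ : ℕ) (z₀ : Fin M₀ → E3) (c₀ : Fin M₀), 𝓥 M₀ z₀ c₀ 0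

/-- (piece) [route statement · this cell; NOT a literature fact] `ModesLE 𝓥 𝓥'` — every `𝓥`-admissible field is `𝓥'`-admissible. -/
def ModesLE (𝓥 𝓥' : ModeFam) : Prop := ∀ (M₀ : ℕ) (z₀ : Fin M₀ → E3) (c₀ : Fin M₀) (v : Fin M₀ → E3), 𝓥 M₀ z₀ c₀ v → 𝓥' M₀ z₀ c₀ v

/-- [formal bookkeeping] -/
theorem zeroMem_zeroModes : ZeroMem zeroModes := fun _ _ _ => rfl

/-- [formal bookkeeping] -/
theorem modesLE_refl (𝓥 : ModeFam) : ModesLE 𝓥 𝓥 := fun _ _ _ _ h => h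

/-- [formal bookkeeping] -/
theorem ModesLE.trans {𝓥 𝓥' 𝓥'' : ModeFam} (h : ModesLE 𝓥 𝓥') (h' : ModesLE 𝓥' 𝓥'') : ModesLE 𝓥 𝓥'' :=
  fun M₀ z₀ c₀ v hv => h' M₀ z₀ c₀ v (h M₀ z₀ c₀ v hv)

/-- The zero family is the bottom of every family containing `0`. [formal bookkeeping] -/
theorem modesLE_zeroModes {𝓥 : ModeFam} (h0 : ZeroMem 𝓥) : ModesLE zeroModes 𝓥 := by
  intro M₀ z₀ c₀ v hv
  have hv' : v = 0 := hv
  rw [hv']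
  exact h0 M₀ z₀ c₀

/-! ## §1. Soft-corrected charts -/

/-- (piece) [route statement · this cell; NOT a literature fact] ★ **`ChartByGBS 𝓘 τ T B z c z₀ c₀ e v`** — the GB-chart `ChartByGB 𝓘 τ T B z c z₀ c₀ e` with every DEVIATION measured against the soft-corrected host
positions `z₀ + v` (site: `‖D a − (v (e a) − v c₀)‖`, pair: `‖(D a − D b) − (v (e a) − v (e b))‖`), while family membership, the tables `T(z₀)`, `B(z₀)`
and the covering radius are read at the PLAIN host `z₀` (no class / relevance predicate flips under the correction). -/
def ChartByGBS (𝓘 : ChartFam) (τ : ℝ) (T : SlackTab) (B : PairTab) {M : ℕ} (z : Fin M → E3) (c : Fin M) {M₀ : ℕ} (z₀ : Fin M₀ → E3)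
    (c₀ : Fin M₀) (e : Fin M → Fin M₀) (v : Fin M₀ → E3) : Prop :=
  𝓘 M₀ z₀ c₀ ∧ e c = c₀ ∧
    (∀ a, dist (z a) (z c) ≤ 63 / 10 → ‖((z a - z c) - (z₀ (e a) - z₀ c₀)) - (v (e a) - v c₀)‖ ≤ τ) ∧
    (∀ a, dist (z a) (z c) ≤ 63 / 10 → ‖((z a - z c) - (z₀ (e a) - z₀ c₀)) - (v (e a) - v c₀)‖ ≤ T M₀ z₀ c₀ (e a)) ∧
    (∀ a b, dist (z a) (z c) ≤ 63 / 10 → dist (z b) (z c) ≤ 63 / 10 → e a = e b → a = b) ∧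
    (∀ b₀, dist (z₀ b₀) (z₀ c₀) ≤ 63 / 10 - τ → ∃ a, dist (z a) (z c) ≤ 63 / 10 ∧ e a = b₀) ∧
    (∀ a b, dist (z a) (z c) ≤ 63 / 10 → dist (z b) (z c) ≤ 63 / 10 →
      ‖((z a - z b) - (z₀ (e a) - z₀ (e b))) - (v (e a) - v (e b))‖ ≤ B M₀ z₀ c₀ (e a) (e b))

/-- (piece) [route statement · this cell; NOT a literature fact] **`ChartByGS 𝓘 τ T z c z₀ c₀ e v`** — the same for the GRADED chart `ChartByG` (no pair clause): the soft-corrected form of the cover's chart. -/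
def ChartByGS (𝓘 : ChartFam) (τ : ℝ) (T : SlackTab) {M : ℕ} (z : Fin M → E3) (c : Fin M) {M₀ : ℕ} (z₀ : Fin M₀ → E3)
    (c₀ : Fin M₀) (e : Fin M → Fin M₀) (v : Fin M₀ → E3) : Prop :=
  𝓘 M₀ z₀ c₀ ∧ e c = c₀ ∧
    (∀ a, dist (z a) (z c) ≤ 63 / 10 → ‖((z a - z c) - (z₀ (e a) - z₀ c₀)) - (v (e a) - v c₀)‖ ≤ τ) ∧
    (∀ a, dist (z a) (z c) ≤ 63 / 10 → ‖((z a - z c) - (z₀ (e a) - z₀ c₀)) - (v (e a) - v c₀)‖ ≤ T M₀ z₀ c₀ (e a)) ∧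
    (∀ a b, dist (z a) (z c) ≤ 63 / 10 → dist (z b) (z c) ≤ 63 / 10 → e a = e b → a = b) ∧
    (∀ b₀, dist (z₀ b₀) (z₀ c₀) ≤ 63 / 10 - τ → ∃ a, dist (z a) (z c) ≤ 63 / 10 ∧ e a = b₀)

section Chart

variable {𝓘 : ChartFam} {τ τ₁ τ₂ : ℝ} {T T₁ T₂ : SlackTab} {B B₁ B₂ : PairTab} {M : ℕ} {z : Fin M → E3} {c : Fin M} {M₀ : ℕ}
  {z₀ : Fin M₀ → E3} {c₀ : Fin M₀} {e : Fin M → Fin M₀} {v : Fin M₀ → E3}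

/-- [formal bookkeeping] -/
theorem ChartByGBS.chartByGS (h : ChartByGBS 𝓘 τ T B z c z₀ c₀ e v) : ChartByGS 𝓘 τ T z c z₀ c₀ e v :=
  ⟨h.1, h.2.1, h.2.2.1, h.2.2.2.1, h.2.2.2.2.1, h.2.2.2.2.2.1⟩

/-- The triangle step: `‖x‖ ≤ ‖x − w‖ + ‖w‖`. [formal bookkeeping] -/
theorem norm_le_of_sub_of (x w : E3) {p q : ℝ} (h₁ : ‖x - w‖ ≤ p) (h₂ : ‖w‖ ≤ q) : ‖x‖ ≤ p + q :=
  calc ‖x‖ = ‖(x - w) + w‖ := by rw [sub_add_cancel]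
    _ ≤ ‖x - w‖ + ‖w‖ := norm_add_le _ _
    _ ≤ p + q := add_le_add h₁ h₂

/-- ★ RECOVERY at chart level: at the zero correction the soft-corrected graded chart IS the graded chart. [formal bookkeeping] -/
theorem chartByGS_zero_iff : ChartByGS 𝓘 τ T z c z₀ c₀ e 0 ↔ ChartByG 𝓘 τ T z c z₀ c₀ e := by
  constructor
  · rintro ⟨hI, hc, hτ, hT, hinj, hcov⟩
    refine ⟨⟨hI, hc, fun a ha => ?_, fun a ha _ => ?_, hinj, hcov⟩, fun a ha => ?_⟩
    · rw [dist_eq_norm]; simpa using hτ a ha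
    · rw [dist_eq_norm]; simpa using hτ a ha
    · rw [dist_eq_norm]; simpa using hT a ha
  · rintro ⟨⟨hI, hc, hτ, -, hinj, hcov⟩, hT⟩
    refine ⟨hI, hc, fun a ha => ?_, fun a ha => ?_, hinj, hcov⟩
    · simpa [← dist_eq_norm] using hτ a ha
    · simpa [← dist_eq_norm] using hT a ha

/-- ★ RECOVERY at chart level: at the zero correction the soft-corrected GB-chart IS the GB-chart. [formal bookkeeping] -/
theorem chartByGBS_zero_iff : ChartByGBS 𝓘 τ T B z c z₀ c₀ e 0 ↔ ChartByGB 𝓘 τ T B z c z₀ c₀ e := by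
  constructor
  · intro h
    refine ⟨chartByGS_zero_iff.1 h.chartByGS, fun a b ha hb => ?_⟩
    rw [dist_eq_norm]; simpa using h.2.2.2.2.2.2 a b ha hb
  · rintro ⟨hG, hP⟩
    obtain ⟨hI, hc, hτ, hT, hinj, hcov⟩ := chartByGS_zero_iff.2 hG
    refine ⟨hI, hc, hτ, hT, hinj, hcov, fun a b ha hb => ?_⟩
    simpa [← dist_eq_norm] using hP a b ha hb

/-- ★★ THE SITE SEAM: a soft-corrected graded chart at `(τ₁, T₁)` whose correction field has site envelope `(τ₂, T₂)` is a graded chart at any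
`(τ, T)` dominating the sums. [folklore: triangle inequality] -/
theorem chartByG_of_chartByGS (h : ChartByGS 𝓘 τ₁ T₁ z c z₀ c₀ e v) (hvτ : ∀ a, ‖v a - v c₀‖ ≤ τ₂) (hvT : ∀ a, ‖v a - v c₀‖ ≤ T₂ M₀ z₀ c₀ a)
    (hτ : τ₁ + τ₂ ≤ τ) (hT : ∀ a, T₁ M₀ z₀ c₀ a + T₂ M₀ z₀ c₀ a ≤ T M₀ z₀ c₀ a) : ChartByG 𝓘 τ T z c z₀ c₀ e := by
  obtain ⟨hI, hc, h₁, h₂, hinj, hcov⟩ := h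
  have h0 : 0 ≤ τ₂ := by simpa using hvτ c₀
  have hτ₁ : τ₁ ≤ τ := by linarith
  refine ⟨⟨hI, hc, fun a ha => ?_, fun a ha _ => ?_, hinj, fun b₀ hb₀ => hcov b₀ (by linarith)⟩, fun a ha => ?_⟩
  · rw [dist_eq_norm]; exact (norm_le_of_sub_of _ _ (h₁ a ha) (hvτ (e a))).trans hτ
  · rw [dist_eq_norm]; exact (norm_le_of_sub_of _ _ (h₁ a ha) (hvτ (e a))).trans hτ
  · rw [dist_eq_norm]; exact (norm_le_of_sub_of _ _ (h₂ a ha) (hvT (e a))).trans (hT (e a))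

/-- ★★ THE PAIR SEAM: a soft-corrected GB-chart at `(τ₁, T₁, B₁)` whose correction field has envelope `(τ₂, T₂, B₂)` is a GB-chart at any `(τ, T, B)`
dominating the sums — site clauses AND the bond-difference clause. [folklore: triangle inequality] -/
theorem chartByGB_of_chartByGBS (h : ChartByGBS 𝓘 τ₁ T₁ B₁ z c z₀ c₀ e v) (hvτ : ∀ a, ‖v a - v c₀‖ ≤ τ₂)
    (hvT : ∀ a, ‖v a - v c₀‖ ≤ T₂ M₀ z₀ c₀ a) (hvB : ∀ a b, ‖v a - v b‖ ≤ B₂ M₀ z₀ c₀ a b) (hτ : τ₁ + τ₂ ≤ τ)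
    (hT : ∀ a, T₁ M₀ z₀ c₀ a + T₂ M₀ z₀ c₀ a ≤ T M₀ z₀ c₀ a) (hB : ∀ a b, B₁ M₀ z₀ c₀ a b + B₂ M₀ z₀ c₀ a b ≤ B M₀ z₀ c₀ a b) :
    ChartByGB 𝓘 τ T B z c z₀ c₀ e := by
  refine ⟨chartByG_of_chartByGS h.chartByGS hvτ hvT hτ hT, fun a b ha hb => ?_⟩
  rw [dist_eq_norm]
  exact (norm_le_of_sub_of _ _ (h.2.2.2.2.2.2 a b ha hb) (hvB (e a) (e b))).trans (hB (e a) (e b))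

end Chart

/-! ## §2. The leaves: (S) the soft envelope, (T) the stiff refinement, (K_S) the stiff cover — and their order -/

/-- (piece) [route statement · this cell; NOT a literature fact] ★★ **(S) `SoftEnvelope 𝓥 τ₂ T₂ B₂`** [KINEMATIC × ANHARMONIC · UNDECIDED · INSTRUMENTABLE «SOFT-85»] — at every host, every admissible soft field has site
amplitude (relative to the centre) `≤ τ₂` and `≤ T₂(z₀)(a)`, and pair oscillation `‖v a − v b‖ ≤ B₂(z₀)(a, b)`.  Per UNIT amplitude this is a finite
computation on the modes; the AMPLITUDE at which soft content stays admissible (force cap `σ₁`, window, clean, mono-phase) is the anharmonic force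
balance — the one number per host class the instrument measures.  Antitone in `𝓥`, monotone in the three tables; free at `𝓥 = zeroModes`. -/
def SoftEnvelope (𝓥 : ModeFam) (τ₂ : ℝ) (T₂ : SlackTab) (B₂ : PairTab) : Prop :=
  ∀ (M₀ : ℕ) (z₀ : Fin M₀ → E3) (c₀ : Fin M₀) (v : Fin M₀ → E3), 𝓥 M₀ z₀ c₀ v →
    (∀ a, ‖v a - v c₀‖ ≤ τ₂) ∧ (∀ a, ‖v a - v c₀‖ ≤ T₂ M₀ z₀ c₀ a) ∧ (∀ a b, ‖v a - v b‖ ≤ B₂ M₀ z₀ c₀ a b)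

/-- (piece) [route statement · this cell; NOT a literature fact] ★★ **(T) `RefineGBS 𝓘₀ 𝓘 𝓥 ρ ε η₂ τ₀ T₀ τ T B`** [ANALYTIC · the STIFF pair bridge · UNDECIDED] — every admissible clean mono-phase far-class
`η₂`-good-centred cluster graded-charted by the coarse family `𝓘₀` at `(τ₀, T₀)` is, modulo a linear isometry, soft-correctedly GB-charted by a host of `𝓘` at
`(τ, T, B)` for SOME admissible soft field `v ∈ 𝓥(host)`.  = (D_GB) `RefineGB` with the freedom to subtract soft content first: WEAKER than (D_GB) at the same
data whenever `0 ∈ 𝓥`; equal to it at `𝓥 = zeroModes`.  Mechanism: coercive interior regularity on the STIFF complement (…SoftSplitToy). -/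
def RefineGBS (𝓘₀ 𝓘 : ChartFam) (𝓥 : ModeFam) (ρ ε η₂ τ₀ : ℝ) (T₀ : SlackTab) (τ : ℝ) (T : SlackTab) (B : PairTab) : Prop :=
  ∀ (M : ℕ) (z : Fin M → E3) (c : Fin M) (M₀ : ℕ) (z₀ : Fin M₀ → E3) (c₀ : Fin M₀) (e : Fin M → Fin M₀),
    Admissible M z c → CleanBall (63 / 10) z c → MonoPhaseBall (63 / 10) z c → ¬NearHomIsoAt ρ ε z c → GoodAtScale η₂ (3 / 2) z c →
      ChartByG 𝓘₀ τ₀ T₀ z c z₀ c₀ e →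
        ∃ (R : E3 ≃ₗᵢ[ℝ] E3) (M₁ : ℕ) (z₁ : Fin M₁ → E3) (c₁ : Fin M₁) (e₁ : Fin M → Fin M₁) (v : Fin M₁ → E3),
          𝓥 M₁ z₁ c₁ v ∧ ChartByGBS 𝓘 τ T B (⇑R ∘ z) c z₁ c₁ e₁ v

/-- (piece) [route statement · this cell; NOT a literature fact] ★★ **(K_S) `FamilyCoverGS 𝓘 𝓥 ρ ε η₂ τ T`** [KINEMATIC/ANALYTIC · the STIFF cover · UNDECIDED] — every admissible clean mono-phase far-class `η₂`-good-centred cluster is,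
modulo a linear isometry, soft-correctedly graded-charted by a host of `𝓘` at `(τ, T)` for some `v ∈ 𝓥(host)`.  = (K) `FamilyCoverG` with the freedom to
subtract soft content first; WEAKER than (K) whenever `0 ∈ 𝓥`, equal at `zeroModes`. -/
def FamilyCoverGS (𝓘 : ChartFam) (𝓥 : ModeFam) (ρ ε η₂ τ : ℝ) (T : SlackTab) : Prop :=
  ∀ (M : ℕ) (z : Fin M → E3) (c : Fin M), Admissible M z c → CleanBall (63 / 10) z c → MonoPhaseBall (63 / 10) z c → ¬NearHomIsoAt ρ ε z c →
    GoodAtScale η₂ (3 / 2) z c →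
      ∃ (R : E3 ≃ₗᵢ[ℝ] E3) (M₀ : ℕ) (z₀ : Fin M₀ → E3) (c₀ : Fin M₀) (e : Fin M → Fin M₀) (v : Fin M₀ → E3),
        𝓥 M₀ z₀ c₀ v ∧ ChartByGS 𝓘 τ T (⇑R ∘ z) c z₀ c₀ e v

section Leaves

variable {𝓘₀ 𝓘 : ChartFam} {𝓥 𝓥' : ModeFam} {ρ ε η₂ τ₀ τ τ₁ τ₂ : ℝ} {T₀ T T₁ T₂ : SlackTab} {B B₁ B₂ : PairTab}

/-- ★★★ THE PAIR NODE: (T) ∧ (S) ∧ [sums dominated] ⟹ (D_GB) `RefineGB 𝓘₀ 𝓘 ρ ε η₂ τ₀ T₀ τ T B`. [folklore: the pair seam under the binders] -/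
theorem refineGB_of_refineGBS_of_softEnvelope (hT : RefineGBS 𝓘₀ 𝓘 𝓥 ρ ε η₂ τ₀ T₀ τ₁ T₁ B₁) (hS : SoftEnvelope 𝓥 τ₂ T₂ B₂) (hτ : τ₁ + τ₂ ≤ τ)
    (hTT : ∀ (M₀ : ℕ) (z₀ : Fin M₀ → E3) (c₀ : Fin M₀) (a : Fin M₀), T₁ M₀ z₀ c₀ a + T₂ M₀ z₀ c₀ a ≤ T M₀ z₀ c₀ a)
    (hBB : ∀ (M₀ : ℕ) (z₀ : Fin M₀ → E3) (c₀ : Fin M₀) (a b : Fin M₀), B₁ M₀ z₀ c₀ a b + B₂ M₀ z₀ c₀ a b ≤ B M₀ z₀ c₀ a b) :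
    RefineGB 𝓘₀ 𝓘 ρ ε η₂ τ₀ T₀ τ T B := by
  intro M z c M₀ z₀ c₀ e hz hcl hm hn hg hch
  obtain ⟨R, M₁, z₁, c₁, e₁, v, hv, hchS⟩ := hT M z c M₀ z₀ c₀ e hz hcl hm hn hg hch
  obtain ⟨hvτ, hvT, hvB⟩ := hS M₁ z₁ c₁ v hv
  exact ⟨R, M₁, z₁, c₁, e₁, chartByGB_of_chartByGBS hchS hvτ hvT hvB hτ (hTT M₁ z₁ c₁) (hBB M₁ z₁ c₁)⟩

/-- ★★★ THE COVER NODE: (K_S) ∧ (S) ∧ [sums dominated] ⟹ (K) `FamilyCoverG 𝓘 ρ ε η₂ τ T`. [folklore: the site seam under the binders] -/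
theorem familyCoverG_of_familyCoverGS_of_softEnvelope (hK : FamilyCoverGS 𝓘 𝓥 ρ ε η₂ τ₁ T₁) (hS : SoftEnvelope 𝓥 τ₂ T₂ B₂) (hτ : τ₁ + τ₂ ≤ τ)
    (hTT : ∀ (M₀ : ℕ) (z₀ : Fin M₀ → E3) (c₀ : Fin M₀) (a : Fin M₀), T₁ M₀ z₀ c₀ a + T₂ M₀ z₀ c₀ a ≤ T M₀ z₀ c₀ a) :
    FamilyCoverG 𝓘 ρ ε η₂ τ T := by
  intro M z c hz hcl hm hn hg
  obtain ⟨R, M₀, z₀, c₀, e, v, hv, hchS⟩ := hK M z c hz hcl hm hn hg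
  obtain ⟨hvτ, hvT, -⟩ := hS M₀ z₀ c₀ v hv
  exact ⟨R, M₀, z₀, c₀, e, chartByG_of_chartByGS hchS hvτ hvT hτ (hTT M₀ z₀ c₀)⟩

/-- ★ (T) IS WEAKER than (D_GB) at the same data whenever the zero field is admissible. [formal bookkeeping] -/
theorem refineGBS_of_refineGB (h0 : ZeroMem 𝓥) (h : RefineGB 𝓘₀ 𝓘 ρ ε η₂ τ₀ T₀ τ T B) : RefineGBS 𝓘₀ 𝓘 𝓥 ρ ε η₂ τ₀ T₀ τ T B := by
  intro M z c M₀ z₀ c₀ e hz hcl hm hn hg hch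
  obtain ⟨R, M₁, z₁, c₁, e₁, hchB⟩ := h M z c M₀ z₀ c₀ e hz hcl hm hn hg hch
  exact ⟨R, M₁, z₁, c₁, e₁, 0, h0 M₁ z₁ c₁, chartByGBS_zero_iff.2 hchB⟩

/-- ★ (K_S) IS WEAKER than (K) at the same data whenever the zero field is admissible. [formal bookkeeping] -/
theorem familyCoverGS_of_familyCoverG (h0 : ZeroMem 𝓥) (h : FamilyCoverG 𝓘 ρ ε η₂ τ T) : FamilyCoverGS 𝓘 𝓥 ρ ε η₂ τ T := by
  intro M z c hz hcl hm hn hg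
  obtain ⟨R, M₀, z₀, c₀, e, hch⟩ := h M z c hz hcl hm hn hg
  exact ⟨R, M₀, z₀, c₀, e, 0, h0 M₀ z₀ c₀, chartByGS_zero_iff.2 hch⟩

/-- ★ RECOVERY: at the zero family (T) IS (D_GB) — the record is the degenerate instance of the split. [formal bookkeeping] -/
theorem refineGBS_zeroModes_iff : RefineGBS 𝓘₀ 𝓘 zeroModes ρ ε η₂ τ₀ T₀ τ T B ↔ RefineGB 𝓘₀ 𝓘 ρ ε η₂ τ₀ T₀ τ T B := by
  refine ⟨fun h => ?_, refineGBS_of_refineGB zeroMem_zeroModes⟩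
  intro M z c M₀ z₀ c₀ e hz hcl hm hn hg hch
  obtain ⟨R, M₁, z₁, c₁, e₁, v, hv, hchS⟩ := h M z c M₀ z₀ c₀ e hz hcl hm hn hg hch
  have hv0 : v = 0 := hv
  subst hv0
  exact ⟨R, M₁, z₁, c₁, e₁, chartByGBS_zero_iff.1 hchS⟩

/-- ★ RECOVERY: at the zero family (K_S) IS (K). [formal bookkeeping] -/
theorem familyCoverGS_zeroModes_iff : FamilyCoverGS 𝓘 zeroModes ρ ε η₂ τ T ↔ FamilyCoverG 𝓘 ρ ε η₂ τ T := by
  refine ⟨fun h => ?_, familyCoverGS_of_familyCoverG zeroMem_zeroModes⟩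
  intro M z c hz hcl hm hn hg
  obtain ⟨R, M₀, z₀, c₀, e, v, hv, hchS⟩ := h M z c hz hcl hm hn hg
  have hv0 : v = 0 := hv
  subst hv0
  exact ⟨R, M₀, z₀, c₀, e, chartByGS_zero_iff.1 hchS⟩

/-- ★ (S) is FREE at the zero family (nonnegative tables). [formal bookkeeping] -/
theorem softEnvelope_zeroModes (hτ : 0 ≤ τ₂) (hT : ∀ (M₀ : ℕ) (z₀ : Fin M₀ → E3) (c₀ : Fin M₀) (a : Fin M₀), 0 ≤ T₂ M₀ z₀ c₀ a)
    (hB : ∀ (M₀ : ℕ) (z₀ : Fin M₀ → E3) (c₀ : Fin M₀) (a b : Fin M₀), 0 ≤ B₂ M₀ z₀ c₀ a b) : SoftEnvelope zeroModes τ₂ T₂ B₂ := by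
  intro M₀ z₀ c₀ v hv
  have hv0 : v = 0 := hv
  subst hv0
  exact ⟨fun a => by simpa using hτ, fun a => by simpa using hT M₀ z₀ c₀ a, fun a b => by simpa using hB M₀ z₀ c₀ a b⟩

/-- THE TRADE, stated exactly: enlarging the mode family WEAKENS the stiff leaf (T)… [formal bookkeeping] -/
theorem RefineGBS.mono_modes (h : RefineGBS 𝓘₀ 𝓘 𝓥 ρ ε η₂ τ₀ T₀ τ T B) (hle : ModesLE 𝓥 𝓥') : RefineGBS 𝓘₀ 𝓘 𝓥' ρ ε η₂ τ₀ T₀ τ T B := by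
  intro M z c M₀ z₀ c₀ e hz hcl hm hn hg hch
  obtain ⟨R, M₁, z₁, c₁, e₁, v, hv, hchS⟩ := h M z c M₀ z₀ c₀ e hz hcl hm hn hg hch
  exact ⟨R, M₁, z₁, c₁, e₁, v, hle M₁ z₁ c₁ v hv, hchS⟩

/-- … and the stiff cover (K_S)… [formal bookkeeping] -/
theorem FamilyCoverGS.mono_modes (h : FamilyCoverGS 𝓘 𝓥 ρ ε η₂ τ T) (hle : ModesLE 𝓥 𝓥') : FamilyCoverGS 𝓘 𝓥' ρ ε η₂ τ T := by
  intro M z c hz hcl hm hn hg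
  obtain ⟨R, M₀, z₀, c₀, e, v, hv, hchS⟩ := h M z c hz hcl hm hn hg
  exact ⟨R, M₀, z₀, c₀, e, v, hle M₀ z₀ c₀ v hv, hchS⟩

/-- … and STRENGTHENS the soft leaf (S). [formal bookkeeping] -/
theorem SoftEnvelope.anti_modes (h : SoftEnvelope 𝓥' τ₂ T₂ B₂) (hle : ModesLE 𝓥 𝓥') : SoftEnvelope 𝓥 τ₂ T₂ B₂ :=
  fun M₀ z₀ c₀ v hv => h M₀ z₀ c₀ v (hle M₀ z₀ c₀ v hv)

/-- (S) loosens with its three tables. [formal bookkeeping] -/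
theorem SoftEnvelope.mono {τ₂' : ℝ} {T₂' : SlackTab} {B₂' : PairTab} (h : SoftEnvelope 𝓥 τ₂ T₂ B₂) (hτ : τ₂ ≤ τ₂')
    (hT : ∀ (M₀ : ℕ) (z₀ : Fin M₀ → E3) (c₀ : Fin M₀) (a : Fin M₀), T₂ M₀ z₀ c₀ a ≤ T₂' M₀ z₀ c₀ a)
    (hB : ∀ (M₀ : ℕ) (z₀ : Fin M₀ → E3) (c₀ : Fin M₀) (a b : Fin M₀), B₂ M₀ z₀ c₀ a b ≤ B₂' M₀ z₀ c₀ a b) : SoftEnvelope 𝓥 τ₂' T₂' B₂' := by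
  intro M₀ z₀ c₀ v hv
  obtain ⟨h₁, h₂, h₃⟩ := h M₀ z₀ c₀ v hv
  exact ⟨fun a => (h₁ a).trans hτ, fun a => (h₂ a).trans (hT M₀ z₀ c₀ a), fun a b => (h₃ a b).trans (hB M₀ z₀ c₀ a b)⟩

/-- (D_GB) itself is (T) at ANY family containing `0` followed by the trivial soft share: the converse bookkeeping of the node (so the cut loses nothing). -/
theorem refineGB_iff_exists_split (h0 : ZeroMem 𝓥) :
    RefineGB 𝓘₀ 𝓘 ρ ε η₂ τ₀ T₀ τ T B ↔
      ∃ 𝓦 : ModeFam, ModesLE 𝓦 𝓥 ∧ RefineGBS 𝓘₀ 𝓘 𝓦 ρ ε η₂ τ₀ T₀ τ T B ∧ SoftEnvelope 𝓦 0 (constTol 0) (constPair 0) := by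
  constructor
  · intro h
    exact ⟨zeroModes, modesLE_zeroModes h0, refineGBS_zeroModes_iff.2 h,
      softEnvelope_zeroModes le_rfl (fun _ _ _ _ => le_rfl) (fun _ _ _ _ _ => le_rfl)⟩
  · rintro ⟨𝓦, -, hT, hS⟩
    exact refineGB_of_refineGBS_of_softEnvelope hT hS (by norm_num) (fun M₀ z₀ c₀ a => by simp [constTol])
      (fun M₀ z₀ c₀ a b => by simp [constPair])

end Leaves


end Summit.AtomisticToContinuum.Crystallization.Theorems.FrustratedLawDichotomyStrainedPatchSoftSplit

end
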